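import Summits.HodgeConjecture.CorCM.GaloisOddPrimeNormalStructure
import Summits.HodgeConjecture.CorCM.GaloisLargeDegreeStructure
import HarnessLib

/-!
# THE FIVE SHAPES from a normal subgroup of prime order `p` and index `2ⁿ` — parametrised form (no size hypothesis)

COR-CM (cell `pub-hodgecm2`), binder seat b04 (gen 38), count-neutral own lane «Galois-CM-type classification».  KERNEL ONLY:
theorems; no definition, no named fact, no `sorry`.  `HC_CM` is neither used nor claimed.

Same statements and proofs as `shape_of_isCyclic_sylow` / `shape_of_quaternion_sylow` of `CorCM/GaloisOddPrimeShapes`, with the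
size hypothesis replaced by a given normal subgroup `P₀ ◁ Gal(K/ℚ)` of prime order `M` (`[K:ℚ] = 2ⁿ·M`, `n ≥ 5`): shape C(r) for a
cyclic Sylow `2`-subgroup, shapes Q×, Dic, QK for a generalised quaternion one (`CorCM/GaloisOddPrimeNormalStructure`).  With Sylow
counting (`exists_cyclic_odd_complement_sylow_two_of_forall_dvd`) this gives the shapes for `[K:ℚ] = 32·p`, `p ∈ {11, 13, 17, 19, 23, 29}`,
outside gen 33's bound and below `p ≥ 31` (`shapes_of_forall_dvd`).

## References

* [Shimura1998] G. Shimura, *Abelian Varieties with Complex Multiplication and Modular Functions*, §8.2 Prop. 26, §32.10.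
* [Dodson1984] B. Dodson, *The structure of Galois groups of CM-fields*, Trans. AMS 283 (1984), §3.1.1, §4.1, §5.
* [Rotman1995] J. J. Rotman, *An Introduction to the Theory of Groups*, 4th ed., GTM 148, Thm. 4.12, Thm. 5.46, Thm. 7.41.
-/

noncomputable section

open CategoryTheory CategoryTheory.Limits NumberField
open scoped BigOperators

namespace Summit.HodgeConjecture.CorCM.GaloisModels

open Literature.NumberTheory.ComplexMultiplication Literature.AlgebraicGeometry.HodgeTheory
open Literature.AlgebraicGeometry.Motives (AbelianVariety CMType)
open Literature.AlgebraicGeometry.Pohlmann1968 Summit.HodgeConjecture.CorCM.GaloisRank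
open Literature.AlgebraicGeometry.ComplexMultiplication (IsCMTypeRealisation)
open Literature.Barriers.HodgeConjecture (divisorClassesSpan)

variable {K : Type} [Field K] [NumberField K] [IsCMField K] [IsGalois ℚ K]

/-! ## §1 The shapes from a normal `C_p` -/

/-- **SHAPE C(r): cyclic Sylow `2`-subgroup.**  Given a normal subgroup `P₀` of odd prime order `M` with `[K:ℚ] = 2ⁿ·M`, `n ≥ 5`, `K` GOOD: if a Sylow `2`-subgroup
`S` is cyclic then `Gal(K/ℚ) = ⟨u⟩ ⋊ ⟨x⟩` with `u` of order `M` (prime) generating a normal subgroup, `x` of order `2ⁿ` generating `S`,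
every element `uʲ xⁱ`, and `x u x⁻¹ = uʳ` for some `r`. [cite: Shimura1998, §8.2 Prop. 26 and §32.10] [cite: Dodson1984, §5]
[cite: Rotman1995, Thm. 4.12 and Thm. 7.41] -/
theorem shape_of_isCyclic_sylow_of_normal_prime {n M : ℕ} [hMf : Fact M.Prime] (hM2 : M ≠ 2) (hdeg : Module.finrank ℚ K = 2 ^ n * M) (hn : 5 ≤ n)
    (P₀ : Subgroup (K ≃ₐ[ℚ] K)) [P₀.Normal] (hcardP₀ : Nat.card P₀ = M)
    (hgood : ∀ (Φ : CMType K) (φ : K →+* ℂ), IsPrimitive (ℂ ≃+* ℂ) Φ.1 φ → IsNondegenerate Φ) [Fact (Nat.Prime 2)]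
    (S : Sylow 2 (K ≃ₐ[ℚ] K)) (hS : IsCyclic (S : Subgroup (K ≃ₐ[ℚ] K))) :
    M.Prime ∧ ∃ u x : K ≃ₐ[ℚ] K, orderOf u = M ∧ (Subgroup.zpowers u).Normal ∧ orderOf x = 2 ^ n ∧
      Subgroup.zpowers x = (S : Subgroup (K ≃ₐ[ℚ] K)) ∧ (∀ g : K ≃ₐ[ℚ] K, ∃ j i : ℕ, g = u ^ j * x ^ i) ∧
      ∃ r : ℕ, x * u * x⁻¹ = u ^ r := by
  classical
  obtain ⟨P, hPn, hcardP, hMp, hPcyc, -, hall⟩ := exists_cyclic_odd_complement_sylow_two_of_normal_prime hM2 hdeg hn P₀ hcardP₀ hgood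
  obtain ⟨hPS, hcardS, -⟩ := hall S
  haveI := hPn
  -- generators
  obtain ⟨uP, huP⟩ := IsCyclic.exists_generator (α := P)
  obtain ⟨xS, hxS⟩ := IsCyclic.exists_generator (α := (S : Subgroup (K ≃ₐ[ℚ] K)))
  set u : K ≃ₐ[ℚ] K := (uP : K ≃ₐ[ℚ] K) with hu
  set x : K ≃ₐ[ℚ] K := (xS : K ≃ₐ[ℚ] K) with hx
  have hou : orderOf u = M := by rw [hu, Subgroup.orderOf_coe, orderOf_eq_card_of_forall_mem_zpowers huP, hcardP]
  have hox : orderOf x = 2 ^ n := by rw [hx, Subgroup.orderOf_coe, orderOf_eq_card_of_forall_mem_zpowers hxS, hcardS]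
  have hPu : Subgroup.zpowers u = P := by
    refine Subgroup.eq_of_le_of_card_ge ((Subgroup.zpowers_le).2 uP.2) ?_
    rw [Nat.card_zpowers, hou, hcardP]
  have hSx : Subgroup.zpowers x = (S : Subgroup (K ≃ₐ[ℚ] K)) := by
    refine Subgroup.eq_of_le_of_card_ge ((Subgroup.zpowers_le).2 xS.2) ?_
    rw [Nat.card_zpowers, hox, hcardS]
  refine ⟨hMp, u, x, hou, by rw [hPu]; exact hPn, hox, hSx, fun g => ?_, ?_⟩
  · obtain ⟨⟨q, s⟩, hqs, -⟩ := Subgroup.isComplement'_def.1 hPS |>.existsUnique g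
    have hq : (q : K ≃ₐ[ℚ] K) ∈ Subgroup.zpowers u := by rw [hPu]; exact q.2
    have hs : (s : K ≃ₐ[ℚ] K) ∈ Subgroup.zpowers x := by rw [hSx]; exact s.2
    obtain ⟨j, hj⟩ := (Submonoid.mem_powers_iff _ _).1 (mem_powers_iff_mem_zpowers.2 hq)
    obtain ⟨i, hi⟩ := (Submonoid.mem_powers_iff _ _).1 (mem_powers_iff_mem_zpowers.2 hs)
    exact ⟨j, i, by rw [hj, hi]; exact hqs.symm⟩
  · have hmem : x * u * x⁻¹ ∈ Subgroup.zpowers u := by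
      rw [hPu]
      exact hPn.conj_mem u (by rw [← hPu]; exact Subgroup.mem_zpowers u) x
    exact exists_conj_eq_pow hmem

/-- **SHAPES Q×, Dic, QK: generalised quaternion Sylow `2`-subgroup.**  Given a normal subgroup `P₀` of odd
prime order `M` (`[K:ℚ] = 2ⁿ·M`, `n ≥ 5`, `K` GOOD): if a Sylow `2`-subgroup `S ≃ Q_{2ⁿ}` then `Gal(K/ℚ) = ⟨u⟩ ⋊ ⟨a, x⟩` with `u` of order `M`
(prime) generating a normal subgroup, `a` of order `2ⁿ⁻¹`, `x ∉ ⟨a⟩`, `x a = a⁻¹ x`, `x² = a^{2ⁿ⁻²}`, every element `uʲ aⁱ` or `uʲ x aⁱ`,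
and the action is ONE OF: `a`, `x` centralise `u` (shape Q×); `a` centralises and `x` inverts `u` (shape Dic); `a` inverts and `x`
centralises `u` (shape QK). [cite: Shimura1998, §8.2 Prop. 26 and §32.10] [cite: Dodson1984, §5] [cite: Rotman1995, Thm. 4.12, Thm. 5.46 and Thm. 7.41] -/
theorem shape_of_quaternion_sylow_of_normal_prime {n M : ℕ} [hMf : Fact M.Prime] (hM2 : M ≠ 2) (hdeg : Module.finrank ℚ K = 2 ^ n * M) (hn : 5 ≤ n)
    (P₀ : Subgroup (K ≃ₐ[ℚ] K)) [P₀.Normal] (hcardP₀ : Nat.card P₀ = M)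
    (hgood : ∀ (Φ : CMType K) (φ : K →+* ℂ), IsPrimitive (ℂ ≃+* ℂ) Φ.1 φ → IsNondegenerate Φ) [Fact (Nat.Prime 2)]
    (S : Sylow 2 (K ≃ₐ[ℚ] K)) (f : (S : Subgroup (K ≃ₐ[ℚ] K)) ≃* QuaternionGroup (2 ^ (n - 2))) :
    M.Prime ∧ ∃ u a x : K ≃ₐ[ℚ] K, orderOf u = M ∧ (Subgroup.zpowers u).Normal ∧ orderOf a = 2 ^ (n - 1) ∧
      a ∈ (S : Subgroup (K ≃ₐ[ℚ] K)) ∧ x ∈ (S : Subgroup (K ≃ₐ[ℚ] K)) ∧ x ∉ Subgroup.zpowers a ∧ x * a = a⁻¹ * x ∧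
      x * x = a ^ 2 ^ (n - 2) ∧ (∀ g : K ≃ₐ[ℚ] K, ∃ j i : ℕ, g = u ^ j * a ^ i ∨ g = u ^ j * (x * a ^ i)) ∧
      ((a * u * a⁻¹ = u ∧ x * u * x⁻¹ = u) ∨ (a * u * a⁻¹ = u ∧ x * u * x⁻¹ = u⁻¹) ∨ (a * u * a⁻¹ = u⁻¹ ∧ x * u * x⁻¹ = u)) := by
  classical
  haveI : NeZero (2 ^ (n - 2)) := ⟨by positivity⟩
  obtain ⟨P, hPn, hcardP, hMp, hPcyc, -, hall⟩ := exists_cyclic_odd_complement_sylow_two_of_normal_prime hM2 hdeg hn P₀ hcardP₀ hgood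
  obtain ⟨hPS, hcardS, -⟩ := hall S
  haveI := hPn
  obtain ⟨uP, huP⟩ := IsCyclic.exists_generator (α := P)
  set u : K ≃ₐ[ℚ] K := (uP : K ≃ₐ[ℚ] K) with hu
  have hou : orderOf u = M := by rw [hu, Subgroup.orderOf_coe, orderOf_eq_card_of_forall_mem_zpowers huP, hcardP]
  have hPu : Subgroup.zpowers u = P := by
    refine Subgroup.eq_of_le_of_card_ge ((Subgroup.zpowers_le).2 uP.2) ?_
    rw [Nat.card_zpowers, hou, hcardP]
  have hconj : ∀ g : K ≃ₐ[ℚ] K, ∃ r : ℕ, g * u * g⁻¹ = u ^ r := fun g => by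
    refine exists_conj_eq_pow ?_
    rw [hPu]
    exact hPn.conj_mem u (by rw [← hPu]; exact Subgroup.mem_zpowers u) g
  -- quaternion data on `S`
  obtain ⟨a, x₀, haS, hx₀S, hform₀, hx₀a, hx₀a', hx₀x₀, -⟩ := exists_index_two_data_of_mulEquiv_quaternionGroup _ f
  -- `orderOf a = 2^(n-1)`: `⟨a⟩` has index `2` in `S`
  have hoa : orderOf a = 2 ^ (n - 1) := by
    have hle : Nat.card (S : Subgroup (K ≃ₐ[ℚ] K)) ≤ 2 * orderOf a := by
      have hAS : Subgroup.zpowers a ≤ (S : Subgroup (K ≃ₐ[ℚ] K)) := (Subgroup.zpowers_le).2 haS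
      let φ : Bool × Subgroup.zpowers a → (S : Subgroup (K ≃ₐ[ℚ] K)) := fun bt =>
        if bt.1 then ⟨x₀ * bt.2, (S : Subgroup (K ≃ₐ[ℚ] K)).mul_mem hx₀S (hAS bt.2.2)⟩ else ⟨bt.2, hAS bt.2.2⟩
      have hφ : Function.Surjective φ := by
        intro s
        obtain ⟨i, hi⟩ := hform₀ s s.2
        rcases hi with hi | hi
        · exact ⟨(false, ⟨a ^ i, Subgroup.npow_mem_zpowers a i⟩), Subtype.ext (by simp [φ, hi])⟩
        · exact ⟨(true, ⟨a ^ i, Subgroup.npow_mem_zpowers a i⟩), Subtype.ext (by simp [φ, hi])⟩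
      calc Nat.card (S : Subgroup (K ≃ₐ[ℚ] K)) ≤ Nat.card (Bool × Subgroup.zpowers a) := Nat.card_le_card_of_surjective φ hφ
        _ = 2 * orderOf a := by rw [Nat.card_prod, Nat.card_zpowers, Nat.card_eq_fintype_card, Fintype.card_bool]
    have hdvd : orderOf a ∣ 2 ^ n := by
      rw [← hcardS, ← Subgroup.orderOf_mk a haS]
      exact orderOf_dvd_natCard (⟨a, haS⟩ : (S : Subgroup (K ≃ₐ[ℚ] K)))
    obtain ⟨j, hjn, hj⟩ := (Nat.dvd_prime_pow Nat.prime_two).1 hdvd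
    have hne : orderOf a ≠ 2 ^ n := fun h => by
      apply hx₀a
      have heq : Subgroup.zpowers a = (S : Subgroup (K ≃ₐ[ℚ] K)) :=
        Subgroup.eq_of_le_of_card_ge ((Subgroup.zpowers_le).2 haS) (by rw [Nat.card_zpowers, h, hcardS])
      rw [heq]
      exact hx₀S
    rw [hcardS] at hle
    rw [hj] at hle hne ⊢
    have hjn' : j ≠ n := fun h => hne (by rw [h])
    have hj2 : n ≤ j + 1 := by
      by_contra hlt
      have h1 : 2 * 2 ^ j ≤ 2 ^ (n - 1) := by
        rw [← pow_succ']
        exact Nat.pow_le_pow_right two_pos (by omega)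
      have h2 : 2 ^ (n - 1) < 2 ^ n := Nat.pow_lt_pow_right (by norm_num) (by omega)
      omega
    congr 1
    omega
  -- commutator `[a, x₀] = a²`, so `a²` and `x₀² = a^{2ⁿ⁻²}` centralise `u`
  obtain ⟨ra, hra⟩ := hconj a
  obtain ⟨sa, hsa⟩ := hconj a⁻¹
  rw [inv_inv] at hsa
  obtain ⟨rx, hrx⟩ := hconj x₀
  obtain ⟨sx, hsx⟩ := hconj x₀⁻¹
  rw [inv_inv] at hsx
  have hxax : x₀ * a * x₀⁻¹ = a⁻¹ := by rw [hx₀a', mul_inv_cancel_right]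
  have hxainv : x₀ * a⁻¹ * x₀⁻¹ = a := by
    calc x₀ * a⁻¹ * x₀⁻¹ = (x₀ * a * x₀⁻¹)⁻¹ := by group
      _ = a := by rw [hxax, inv_inv]
  have hcomm : a * x₀ * a⁻¹ * x₀⁻¹ = a * a := by
    calc a * x₀ * a⁻¹ * x₀⁻¹ = a * (x₀ * a⁻¹ * x₀⁻¹) := by group
      _ = a * a := by rw [hxainv]
  have haa : a * a * u * (a * a)⁻¹ = u := by
    rw [← hcomm]
    exact commutator_mul_eq_mul hra hrx hsa hsx
  have hn3 : 2 ^ (n - 2) = 2 * 2 ^ (n - 3) := by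
    obtain ⟨n', rfl⟩ := Nat.exists_eq_add_of_le hn
    rw [show 5 + n' - 2 = (5 + n' - 3) + 1 by omega, pow_succ, mul_comm]
  have hxx : x₀ * x₀ * u * (x₀ * x₀)⁻¹ = u := by
    rw [hx₀x₀, hn3, pow_mul, pow_two]
    exact pow_mul_eq_of_mul_eq haa _
  have ha := conj_eq_self_or_inv (p := M) hou hra haa
  have hx := conj_eq_self_or_inv (p := M) hou hrx hxx
  -- normal form `g = uʲ s`, `s ∈ S = {aⁱ, x₀ aⁱ}`
  have hform : ∀ g : K ≃ₐ[ℚ] K, ∃ j i : ℕ, g = u ^ j * a ^ i ∨ g = u ^ j * (x₀ * a ^ i) := fun g => by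
    obtain ⟨⟨q, s⟩, hqs, -⟩ := Subgroup.isComplement'_def.1 hPS |>.existsUnique g
    have hq : (q : K ≃ₐ[ℚ] K) ∈ Subgroup.zpowers u := by rw [hPu]; exact q.2
    obtain ⟨j, hj⟩ := (Submonoid.mem_powers_iff _ _).1 (mem_powers_iff_mem_zpowers.2 hq)
    obtain ⟨i, hi⟩ := hform₀ s s.2
    refine ⟨j, i, ?_⟩
    rcases hi with hi | hi
    · left; rw [hj, ← hi]; exact hqs.symm
    · right; rw [hj, ← hi]; exact hqs.symm
  refine ⟨hMp, ?_⟩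
  -- the case where both `a` and `x₀` invert `u`: replace `x₀` by `a x₀`
  by_cases hboth : a * u * a⁻¹ = u⁻¹ ∧ x₀ * u * x₀⁻¹ = u⁻¹
  · refine ⟨u, a, a * x₀, hou, by rw [hPu]; exact hPn, hoa, haS, (S : Subgroup (K ≃ₐ[ℚ] K)).mul_mem haS hx₀S,
      fun h => hx₀a ?_, ?_, ?_, fun g => ?_, Or.inr (Or.inr ⟨hboth.1, ?_⟩)⟩
    · have : x₀ = a⁻¹ * (a * x₀) := by rw [inv_mul_cancel_left]
      rw [this]
      exact (Subgroup.zpowers a).mul_mem ((Subgroup.zpowers a).inv_mem (Subgroup.mem_zpowers a)) h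
    · rw [mul_assoc, hx₀a', ← mul_assoc, mul_inv_cancel, one_mul, ← mul_assoc, inv_mul_cancel, one_mul]
    · rw [← hx₀x₀]
      calc a * x₀ * (a * x₀) = a * (x₀ * a) * x₀ := by group
        _ = x₀ * x₀ := by rw [hx₀a', ← mul_assoc, mul_inv_cancel, one_mul]
    · obtain ⟨j, i, hg⟩ := hform g
      rcases hg with hg | hg
      · exact ⟨j, i, Or.inl hg⟩
      · refine ⟨j, i + 1, Or.inr ?_⟩
        rw [hg, pow_succ']
        congr 1
        calc x₀ * a ^ i = a * x₀ * a * a ^ i := by rw [mul_assoc a x₀ a, hx₀a', mul_inv_cancel_left]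
          _ = a * x₀ * (a * a ^ i) := by group
    · calc a * x₀ * u * (a * x₀)⁻¹ = a * (x₀ * u * x₀⁻¹) * a⁻¹ := by group
        _ = (a * u * a⁻¹)⁻¹ := by rw [hboth.2]; group
        _ = u := by rw [hboth.1, inv_inv]
  · refine ⟨u, a, x₀, hou, by rw [hPu]; exact hPn, hoa, haS, hx₀S, hx₀a, hx₀a', hx₀x₀, hform, ?_⟩
    rcases ha with ha | ha <;> rcases hx with hx | hx
    · exact Or.inl ⟨ha, hx⟩
    · exact Or.inr (Or.inl ⟨ha, hx⟩)
    · exact Or.inr (Or.inr ⟨ha, hx⟩)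
    · exact absurd ⟨ha, hx⟩ hboth

/-! ## §2 Degrees `2ⁿ·p` with `ord_p(2) > n` -/

/-- **`[K:ℚ] = 2ⁿ·p`, `n ≥ 5`, no `2ⁱ ≡ 1 (mod p)` for the divisors `2ⁱ ≠ 1` of `2ⁿ`, `K` GOOD ⟹ the five shapes**: every Sylow
`2`-subgroup `S` has order `2ⁿ` and either `S` is cyclic with `Gal(K/ℚ)` of shape C(r), or `S ≃ Q_{2ⁿ}` with `Gal(K/ℚ)` of shape Q×, Dic
or QK (e.g. `[K:ℚ] = 32·p`, `p ∈ {11, 13, 17, 19, 23, 29}`). [cite: Rotman1995, Thm. 4.12, Thm. 5.46 and Thm. 7.41]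
[cite: Shimura1998, §8.2 Prop. 26 and §32.10] [cite: Dodson1984, §5] -/
theorem shapes_of_forall_dvd {n p : ℕ} [hp : Fact p.Prime] (hp2 : p ≠ 2) (hdeg : Module.finrank ℚ K = 2 ^ n * p) (hn : 5 ≤ n)
    (hdiv : ∀ d : ℕ, d ∣ 2 ^ n → d ≡ 1 [MOD p] → d = 1)
    (hgood : ∀ (Φ : CMType K) (φ : K →+* ℂ), IsPrimitive (ℂ ≃+* ℂ) Φ.1 φ → IsNondegenerate Φ) [Fact (Nat.Prime 2)]
    (S : Sylow 2 (K ≃ₐ[ℚ] K)) : Nat.card (S : Subgroup (K ≃ₐ[ℚ] K)) = 2 ^ n ∧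
      ((IsCyclic (S : Subgroup (K ≃ₐ[ℚ] K)) ∧ ∃ u x : K ≃ₐ[ℚ] K, orderOf u = p ∧ (Subgroup.zpowers u).Normal ∧ orderOf x = 2 ^ n ∧
          Subgroup.zpowers x = (S : Subgroup (K ≃ₐ[ℚ] K)) ∧ (∀ g : K ≃ₐ[ℚ] K, ∃ j i : ℕ, g = u ^ j * x ^ i) ∧
          ∃ r : ℕ, x * u * x⁻¹ = u ^ r) ∨
       (Nonempty ((S : Subgroup (K ≃ₐ[ℚ] K)) ≃* QuaternionGroup (2 ^ (n - 2))) ∧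
          ∃ u a x : K ≃ₐ[ℚ] K, orderOf u = p ∧ (Subgroup.zpowers u).Normal ∧ orderOf a = 2 ^ (n - 1) ∧
            a ∈ (S : Subgroup (K ≃ₐ[ℚ] K)) ∧ x ∈ (S : Subgroup (K ≃ₐ[ℚ] K)) ∧ x ∉ Subgroup.zpowers a ∧ x * a = a⁻¹ * x ∧
            x * x = a ^ 2 ^ (n - 2) ∧ (∀ g : K ≃ₐ[ℚ] K, ∃ j i : ℕ, g = u ^ j * a ^ i ∨ g = u ^ j * (x * a ^ i)) ∧
            ((a * u * a⁻¹ = u ∧ x * u * x⁻¹ = u) ∨ (a * u * a⁻¹ = u ∧ x * u * x⁻¹ = u⁻¹) ∨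
              (a * u * a⁻¹ = u⁻¹ ∧ x * u * x⁻¹ = u)))) := by
  classical
  obtain ⟨P, hPn, hcardP, -, -, -, hall⟩ := exists_cyclic_odd_complement_sylow_two_of_forall_dvd hp2 hdeg hn hdiv hgood
  haveI := hPn
  obtain ⟨-, hcardS, hS⟩ := hall S
  refine ⟨hcardS, ?_⟩
  rcases hS with hcyc | ⟨⟨f⟩⟩
  · exact Or.inl ⟨hcyc, (shape_of_isCyclic_sylow_of_normal_prime hp2 hdeg hn P hcardP hgood S hcyc).2⟩
  · exact Or.inr ⟨⟨f⟩, (shape_of_quaternion_sylow_of_normal_prime hp2 hdeg hn P hcardP hgood S f).2⟩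

/-! ## §3 BAD: a Sylow `2`-subgroup that is neither cyclic nor generalised quaternion -/

/-- **A normal `C_p` of index `2ⁿ ≥ 32` next to a Sylow `2`-subgroup that is NEITHER cyclic NOR generalised quaternion ⟹ BAD**: `K`
carries a SIMPLE DEGENERATE abelian variety of dimension `[K:ℚ]/2` (a rational `(p,p)` class outside the divisor ring on a power).
[cite: Shimura1998, §6.2 Thm. 3 and §8.2 Prop. 26] [cite: Gordon1999HodgeAVSurvey, Thm. 6.4 and §9.3] [cite: Rotman1995, Thm. 5.46] -/
theorem exists_simple_degenerate_of_sylow_two_of_normal_prime {n M : ℕ} [hMf : Fact M.Prime] (hM2 : M ≠ 2)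
    (hdeg : Module.finrank ℚ K = 2 ^ n * M) (hn : 5 ≤ n) (P₀ : Subgroup (K ≃ₐ[ℚ] K)) [P₀.Normal] (hcardP₀ : Nat.card P₀ = M)
    [Fact (Nat.Prime 2)] (S : Sylow 2 (K ≃ₐ[ℚ] K)) (hS : ¬ IsCyclic (S : Subgroup (K ≃ₐ[ℚ] K)))
    (hS' : IsEmpty ((S : Subgroup (K ≃ₐ[ℚ] K)) ≃* QuaternionGroup (2 ^ (n - 2)))) :
    ∃ (Φ : CMType K) (φ : K →+* ℂ) (X : AbelianVariety ℂ) (ι : 𝓞 K →+* End X)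
      (ϑ : K →+* Module.End ℂ (complexBetti X.X 1)),
      IsPrimitive (ℂ ≃+* ℂ) Φ.1 φ ∧ ¬ IsNondegenerate Φ ∧ IsCMTypeRealisation Φ X ι ϑ ∧ X.IsSimple ∧
      X.dim = Module.finrank ℚ K / 2 ∧
      ∃ n p : ℕ, ∃ x : complexBetti (⨁ fun _ : Fin n => X).X (2 * p), IsRationalClass x ∧
        IsOfHodgeType (⨁ fun _ : Fin n => X).dim (⨁ fun _ : Fin n => X).X (2 * p) p p x ∧
        x ∉ divisorClassesSpan (⨁ fun _ : Fin n => X).X (⨁ fun _ : Fin n => X).dim p :=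
  exists_simple_degenerate_of_not_forall_isNondegenerate fun hgood => by
    rcases (sylow_two_isCyclic_or_quaternion_of_normal_prime hM2 hdeg hn P₀ hcardP₀ hgood S).2 with h | ⟨⟨f⟩⟩
    · exact hS h
    · exact hS'.false f

/-- **`64·p ∣ [K:ℚ] = 2ⁿ·p` and a Sylow `2`-subgroup neither cyclic nor generalised quaternion ⟹ BAD** (no normality hypothesis: for a
GOOD field the Sylow `p`-subgroup would be normal). [cite: Shimura1998, §6.2 Thm. 3 and §8.2 Prop. 26] [cite: Gordon1999HodgeAVSurvey, Thm. 6.4 and §9.3]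
[cite: Rotman1995, Thm. 5.46] -/
theorem exists_simple_degenerate_of_sylow_two_of_dvd {n p : ℕ} (hp : p.Prime) (hp2 : p ≠ 2)
    (hdeg : Module.finrank ℚ K = 2 ^ n * p) (hn : 6 ≤ n) [Fact (Nat.Prime 2)] (S : Sylow 2 (K ≃ₐ[ℚ] K))
    (hS : ¬ IsCyclic (S : Subgroup (K ≃ₐ[ℚ] K))) (hS' : IsEmpty ((S : Subgroup (K ≃ₐ[ℚ] K)) ≃* QuaternionGroup (2 ^ (n - 2)))) :
    ∃ (Φ : CMType K) (φ : K →+* ℂ) (X : AbelianVariety ℂ) (ι : 𝓞 K →+* End X)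
      (ϑ : K →+* Module.End ℂ (complexBetti X.X 1)),
      IsPrimitive (ℂ ≃+* ℂ) Φ.1 φ ∧ ¬ IsNondegenerate Φ ∧ IsCMTypeRealisation Φ X ι ϑ ∧ X.IsSimple ∧
      X.dim = Module.finrank ℚ K / 2 ∧
      ∃ n p : ℕ, ∃ x : complexBetti (⨁ fun _ : Fin n => X).X (2 * p), IsRationalClass x ∧
        IsOfHodgeType (⨁ fun _ : Fin n => X).dim (⨁ fun _ : Fin n => X).X (2 * p) p p x ∧
        x ∉ divisorClassesSpan (⨁ fun _ : Fin n => X).X (⨁ fun _ : Fin n => X).dim p :=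
  exists_simple_degenerate_of_not_forall_isNondegenerate fun hgood => by
    rcases structure_of_forall_isNondegenerate_of_dvd hdeg (hp.odd_of_ne_two hp2) hn hgood with ⟨h1, -⟩ | ⟨-, -, hall⟩
    · exact hp.one_lt.ne' h1
    · rcases (hall S).2 with ⟨u, x, -, -, hox, hSx, -⟩ | ⟨u, a, x, -, -, -, haS, hxS, -⟩
      · apply hS
        rw [← hSx]
        infer_instance
      · obtain ⟨-, hS2⟩ := sylow_two_isCyclic_or_quaternion_of_odd_prime' hdeg (hp.odd_of_ne_two hp2) (by omega) hp.one_lt.ne'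
          (fun q a m hq hq2 hq31 hd hqm ha => size_condition_of_dvd (by
            rw [hdeg]
            obtain ⟨n', rfl⟩ := Nat.exists_eq_add_of_le hn
            exact Dvd.dvd.mul_right (by rw [pow_add]; exact Dvd.intro _ rfl) p) q a m hq hq2 hq31 hd hqm ha) hgood S
        rcases hS2 with h | ⟨⟨f⟩⟩
        · exact hS h
        · exact hS'.false f

end Summit.HodgeConjecture.CorCM.GaloisModels

end
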